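import Summits.Ventures.HodgeRepro2.T5LevelIdempotentNaturality

/-!
# Admissibility transfers along equivariant maps (Tier-5 kernel support, seat p8)

Admissibility relative to a family `𝒦` of (compact open) subgroups — finite-dimensional
`K`-invariants for every `K ∈ 𝒦` (`IsAdmissible`) — passes to sub-representations along
injective equivariant maps (`IsAdmissible.of_injective`) and, for `K`-finite representations in
characteristic `0` (smooth representations, compact open `K`), to quotients along surjective
equivariant maps (`IsAdmissible.of_surjective`, through the exactness of `V ↦ V^K` of
`T5LevelIdempotentNaturality`), with the rank identity
`dim V^K = dim (ker f)^K + dim W^K` for a surjection `f : V → W` (`finrank_invariants_eq_add`).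
This is the sentence «admissibility passes to subquotients» of the record.  Nothing is asserted
about any specific group.
-/

namespace Summit.Ventures.HodgeRepro2.T5AdmissibleTransfer

open Summit.Ventures.HodgeRepro2.LevelPositivity Summit.Ventures.HodgeRepro2.T5LevelIdempotent
  Summit.Ventures.HodgeRepro2.T5LevelIdempotentNaturality

variable {G : Type*} [Group G] {k : Type*} [Field k] {V : Type*} [AddCommGroup V] [Module k V]
  {W : Type*} [AddCommGroup W] [Module k W] {ρ : Representation k G V} {σ : Representation k G W}
  {f : V →ₗ[k] W}

/-- Admissibility relative to a family `𝒦` of subgroups: `V^K` is finite-dimensional for every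
`K ∈ 𝒦`. -/
def IsAdmissible (ρ : Representation k G V) (𝒦 : Set (Subgroup G)) : Prop :=
  ∀ K ∈ 𝒦, FiniteDimensional k (invariants ρ K)

section Injective

variable (hf : ∀ g v, f (ρ g v) = σ g (f v)) (hi : Function.Injective f)
include hf hi

/-- Along an injective equivariant map, finite-dimensionality of `W^K` gives that of `V^K`. -/
theorem finiteDimensional_invariants_of_injective (K : Subgroup G)
    [FiniteDimensional k (invariants σ K)] : FiniteDimensional k (invariants ρ K) :=
  FiniteDimensional.of_injective (invariantsMap f hf K) (invariantsMap_injective hf K hi)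

/-- Along an injective equivariant map, `dim V^K ≤ dim W^K`. -/
theorem finrank_invariants_le_of_injective (K : Subgroup G)
    [FiniteDimensional k (invariants σ K)] :
    Module.finrank k (invariants ρ K) ≤ Module.finrank k (invariants σ K) :=
  LinearMap.finrank_le_finrank_of_injective (invariantsMap_injective hf K hi)

/-- Admissibility passes to sub-representations. -/
theorem IsAdmissible.of_injective {𝒦 : Set (Subgroup G)} (h : IsAdmissible σ 𝒦) :
    IsAdmissible ρ 𝒦 := fun K hK => by
  haveI := h K hK
  exact finiteDimensional_invariants_of_injective hf hi K

end Injective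

section Surjective

variable [CharZero k] (hf : ∀ g v, f (ρ g v) = σ g (f v)) (hs : Function.Surjective f)
include hf hs

/-- Along a surjective equivariant map (`K`-finite `ρ`, characteristic `0`), finite-dimensionality
of `V^K` gives that of `W^K`. -/
theorem finiteDimensional_invariants_of_surjective {K : Subgroup G} (hK : KFinite ρ K)
    [FiniteDimensional k (invariants ρ K)] : FiniteDimensional k (invariants σ K) :=
  FiniteDimensional.of_surjective (invariantsMap f hf K) (invariantsMap_surjective hf hK hs)

/-- Along a surjective equivariant map (`K`-finite `ρ`, characteristic `0`), `dim W^K ≤ dim V^K`. -/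
theorem finrank_invariants_le_of_surjective {K : Subgroup G} (hK : KFinite ρ K)
    [FiniteDimensional k (invariants ρ K)] :
    Module.finrank k (invariants σ K) ≤ Module.finrank k (invariants ρ K) := by
  have h := LinearMap.finrank_range_le (invariantsMap f hf K)
  rwa [LinearMap.range_eq_top.2 (invariantsMap_surjective hf hK hs), finrank_top] at h

/-- Admissibility passes to quotients (`K`-finite `ρ` on `𝒦`, characteristic `0`). -/
theorem IsAdmissible.of_surjective {𝒦 : Set (Subgroup G)} (h : IsAdmissible ρ 𝒦)
    (h𝒦 : ∀ K ∈ 𝒦, KFinite ρ K) : IsAdmissible σ 𝒦 := fun K hK => by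
  haveI := h K hK
  exact finiteDimensional_invariants_of_surjective hf hs (h𝒦 K hK)

/-- The rank identity for a surjection: `dim V^K = dim (ker f)^K + dim W^K`, where
`(ker f)^K = ker (V^K → W^K)` (`K`-finite `ρ`, characteristic `0`, `V^K` finite-dimensional). -/
theorem finrank_invariants_eq_add {K : Subgroup G} (hK : KFinite ρ K)
    [FiniteDimensional k (invariants ρ K)] :
    Module.finrank k (invariants ρ K) =
      Module.finrank k (LinearMap.ker (invariantsMap f hf K)) +
        Module.finrank k (invariants σ K) := by
  have h := LinearMap.finrank_range_add_finrank_ker (invariantsMap f hf K)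
  rw [LinearMap.range_eq_top.2 (invariantsMap_surjective hf hK hs), finrank_top] at h
  omega

end Surjective

/-- The kernel of `V^K → W^K` consists of the `K`-invariant vectors of `ker f`. -/
theorem mem_ker_invariantsMap_iff (hf : ∀ g v, f (ρ g v) = σ g (f v)) (K : Subgroup G)
    (x : invariants ρ K) : x ∈ LinearMap.ker (invariantsMap f hf K) ↔ (x : V) ∈ LinearMap.ker f := by
  rw [LinearMap.mem_ker, LinearMap.mem_ker, ← Submodule.coe_eq_zero, invariantsMap_apply]

end Summit.Ventures.HodgeRepro2.T5AdmissibleTransfer
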